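import Summits.RiemannHypothesis.RiemannHypothesis.Theorems.PfPersistenceFormVirial
import Summits.RiemannHypothesis.RiemannHypothesis.Theorems.SignConeSignConeOscillatoryDensityDilation
import HarnessLib

/-!
# The dilation orbit in the form domain: composition, two-sided strong continuity, the orbit
# mean-value theorem and the cost of small dilations (pub-rhpf, theory-1 gen 9; helper for crux
# `EvenSectorBarta.EvenOneSignedWindows`, item stmt-RiemannHypothesis-19953; RH-free)

**mechanism/rigidity campaign; no RH claims.**  Companion text:
`run/shared/lean/pub/pub-rhpf/pub-rhpf-theory-1/THEORY-EDGE-9.md`.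

Tools for the Danskin form of the edge law (`PfPersistenceWindowSlopes`,
`PfPersistenceWindowDanskin`), all PROVED:

* `weilDilate_weilDilate`: `(f_η)_{η'} = f_{(1+η')(1+η)−1}` (the dilations form a group);
* `tendsto_integral_norm_sq_weilDilate_sub_nhds`: TWO-SIDED strong continuity of the dilation group
  on `L²`, `∫‖u_η − u‖² → 0` as `η → 0` (right side: `SignCone.DualWitness…`; left side by
  unitarity); `tendsto_integral_norm_sq_weilDilate_seq_sub`: `L²`-convergence `gₙ → f` survives a
  null sequence of dilations of the `gₙ`;
* `exists_re_weilQuadratic_weilDilate_sub_eq`: the MEAN VALUE THEOREM along the dilation orbit of a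
  test function, `Re Q(g_η) − Re Q(g) = η 𝒱(g_ξ)/(1+ξ)` with `ξ` strictly between `0` and `η`
  (`𝒱 = weilDilationVirial`, orbit derivative `hasDerivAt_re_weilQuadratic_weilDilate_of_gt`);
* `tendsto_re_weilQuadratic_weilDilate_sub`: small dilations cost little energy, uniformly on
  bounded-energy unit tests of a window (sequence form of `exists_weilDilate_modulus`).

References: E. Bombieri, Rend. Mat. Acc. Lincei (9) 11 (2000) 183–233, §4 (the dilation);
M. Suzuki (2026), Thm. 1.3 (window continuity of the bottom).
-/

set_option linter.dupNamespace false

noncomputable section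

open MeasureTheory Set Filter Metric
open scoped Topology

namespace Summit.RiemannHypothesis.RiemannHypothesis.Theorems.PfPersistence

open Literature.NumberTheory.LFunctions

/-! ## §1 Dilation algebra and two-sided strong continuity of the dilation group -/

/-- Composition of dilations: `(f_η)_{η'} = f_{(1+η')(1+η)−1}` for `η' > −1`. [folklore] -/
theorem weilDilate_weilDilate (η : ℝ) {η' : ℝ} (hη' : -1 < η') (f : ℝ → ℂ) :
    weilDilate η' (weilDilate η f) = weilDilate ((1 + η') * (1 + η) - 1) f := by
  funext t
  simp only [weilDilate_apply]
  rw [show (1 : ℝ) + ((1 + η') * (1 + η) - 1) = (1 + η') * (1 + η) by ring,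
    Real.sqrt_mul (by linarith : (0 : ℝ) ≤ 1 + η') (1 + η),
    show (1 + η) * ((1 + η') * t) = (1 + η') * (1 + η) * t by ring]
  push_cast
  ring

/-- **Strong continuity of the dilation group on `L²`, two-sided**: `∫‖u_η − u‖² → 0` as `η → 0`
for every `u ∈ L²`. The right-sided statement is
`SignCone.DualWitness.tendsto_integral_norm_sq_weilDilate_sub`; the left side follows by
unitarity: `‖u_η − u‖₂ = ‖(u_η − u)_σ‖₂ = ‖u − u_σ‖₂` with `(1+σ)(1+η) = 1`. [folklore] -/
theorem tendsto_integral_norm_sq_weilDilate_sub_nhds {u : ℝ → ℂ} (hu : MemLp u 2) :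
    Tendsto (fun η ↦ ∫ x, ‖weilDilate η u x - u x‖ ^ 2) (𝓝 0) (𝓝 0) := by
  have hright := SignCone.DualWitness.tendsto_integral_norm_sq_weilDilate_sub hu
  -- unitarity: the value at `η` equals the value at `σ = (1+η)⁻¹ - 1`
  have hsymm : ∀ η : ℝ, -1 < η → ∫ x, ‖weilDilate η u x - u x‖ ^ 2 =
      ∫ x, ‖weilDilate ((1 + η)⁻¹ - 1) u x - u x‖ ^ 2 := by
    intro η hη
    have hc : 0 < 1 + η := by linarith
    have hσ : -1 < (1 + η)⁻¹ - 1 := by linarith [inv_pos.2 hc]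
    rw [← integral_norm_sq_weilDilate (fun x ↦ weilDilate η u x - u x) hσ]
    refine integral_congr_ae (Eventually.of_forall fun x ↦ ?_)
    have e : (1 + ((1 + η)⁻¹ - 1)) * (1 + η) - 1 = 0 := by
      have h1 : (1 + η)⁻¹ * (1 + η) = 1 := inv_mul_cancel₀ hc.ne'
      linear_combination h1
    simp only
    rw [weilDilate_sub ((1 + η)⁻¹ - 1) (weilDilate η u) u x, weilDilate_weilDilate η hσ, e,
      weilDilate_zero, norm_sub_rev]
  rw [Metric.tendsto_nhds]
  intro ε hε
  obtain ⟨δ, hδ, hδε⟩ := Metric.tendsto_nhdsWithin_nhds.1 hright ε hε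
  rw [Metric.eventually_nhds_iff]
  refine ⟨min (δ / 2) (1 / 2), by positivity, fun η hη ↦ ?_⟩
  rw [Real.dist_eq, sub_zero] at hη
  have hη1 : |η| < δ / 2 := lt_of_lt_of_le hη (min_le_left _ _)
  have hη2 : |η| < 1 / 2 := lt_of_lt_of_le hη (min_le_right _ _)
  rcases lt_trichotomy η 0 with hneg | hzero | hpos
  · have hη0 : -1 < η := by linarith [(abs_lt.1 hη2).1]
    have hc : 0 < 1 + η := by linarith
    have hσpos : 0 < (1 + η)⁻¹ - 1 := by
      have : 1 < (1 + η)⁻¹ := (one_lt_inv₀ hc).2 (by linarith)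
      linarith
    have hσδ : (1 + η)⁻¹ - 1 < δ := by
      have e : (1 + η)⁻¹ - 1 = -η / (1 + η) := by field_simp; ring
      rw [e, div_lt_iff₀ hc]
      have : -η < δ / 2 := by linarith [(abs_lt.1 hη1).1]
      nlinarith [mul_pos hδ (show (0 : ℝ) < η + 1 / 2 by linarith [(abs_lt.1 hη2).1])]
    rw [hsymm η hη0]
    exact hδε hσpos (by rwa [Real.dist_eq, sub_zero, abs_of_pos hσpos])
  · subst hzero
    simpa using hε
  · exact hδε hpos (by rw [Real.dist_eq, sub_zero, abs_of_pos hpos]; linarith [(abs_lt.1 hη1).2])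

/-- `L²`-convergence survives a null sequence of dilations of the sequence: if `∫‖gₙ − f‖² → 0`
(`f, gₙ ∈ L²`) and `ζₙ → 0` (`ζₙ > −1`) then `∫‖(gₙ)_{ζₙ} − f‖² → 0` (unitarity, Minkowski,
two-sided strong continuity at `f`). [folklore] -/
theorem tendsto_integral_norm_sq_weilDilate_seq_sub {f : ℝ → ℂ} {g : ℕ → ℝ → ℂ}
    (hf : MemLp f 2) (hg : ∀ n, MemLp (g n) 2)
    (hlim : Tendsto (fun n ↦ ∫ x, ‖g n x - f x‖ ^ 2) atTop (𝓝 0)) {ζ : ℕ → ℝ}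
    (hζ1 : ∀ n, -1 < ζ n) (hζ : Tendsto ζ atTop (𝓝 0)) :
    Tendsto (fun n ↦ ∫ x, ‖weilDilate (ζ n) (g n) x - f x‖ ^ 2) atTop (𝓝 0) := by
  have hA : Tendsto (fun n ↦ Real.sqrt (∫ x, ‖g n x - f x‖ ^ 2)) atTop (𝓝 0) := by
    simpa using hlim.sqrt
  have hB : Tendsto (fun n ↦ Real.sqrt (∫ x, ‖weilDilate (ζ n) f x - f x‖ ^ 2)) atTop (𝓝 0) := by
    simpa using ((tendsto_integral_norm_sq_weilDilate_sub_nhds hf).comp hζ).sqrt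
  have hle : ∀ n, Real.sqrt (∫ x, ‖weilDilate (ζ n) (g n) x - f x‖ ^ 2) ≤
      Real.sqrt (∫ x, ‖g n x - f x‖ ^ 2) +
        Real.sqrt (∫ x, ‖weilDilate (ζ n) f x - f x‖ ^ 2) := by
    intro n
    have hf' : MemLp (weilDilate (ζ n) f) 2 := OddSector.memLp_weilDilate hf (hζ1 n)
    have hg' : MemLp (weilDilate (ζ n) (g n)) 2 := OddSector.memLp_weilDilate (hg n) (hζ1 n)
    have h1 := sqrt_integral_norm_sq_sub_le
      (f := fun x ↦ weilDilate (ζ n) (g n) x - weilDilate (ζ n) f x)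
      (h := fun x ↦ f x - weilDilate (ζ n) f x) (hg'.sub hf') (hf.sub hf')
    have e1 : ∫ x, ‖(weilDilate (ζ n) (g n) x - weilDilate (ζ n) f x) -
        (f x - weilDilate (ζ n) f x)‖ ^ 2 = ∫ x, ‖weilDilate (ζ n) (g n) x - f x‖ ^ 2 := by
      refine integral_congr_ae (Eventually.of_forall fun x ↦ ?_)
      simp only
      ring_nf
    have e2 : ∫ x, ‖weilDilate (ζ n) (g n) x - weilDilate (ζ n) f x‖ ^ 2 =
        ∫ x, ‖g n x - f x‖ ^ 2 := by
      rw [← integral_norm_sq_weilDilate (fun x ↦ g n x - f x) (hζ1 n)]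
      refine integral_congr_ae (Eventually.of_forall fun x ↦ ?_)
      simp only
      rw [weilDilate_sub (ζ n) (g n) f x]
    have e3 : ∫ x, ‖f x - weilDilate (ζ n) f x‖ ^ 2 = ∫ x, ‖weilDilate (ζ n) f x - f x‖ ^ 2 := by
      refine integral_congr_ae (Eventually.of_forall fun x ↦ ?_)
      simp only [norm_sub_rev]
    rw [e1, e2, e3] at h1
    exact h1
  have hsq : Tendsto (fun n ↦ Real.sqrt (∫ x, ‖weilDilate (ζ n) (g n) x - f x‖ ^ 2)) atTop
      (𝓝 0) := by
    refine squeeze_zero (fun n ↦ Real.sqrt_nonneg _) hle ?_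
    simpa using hA.add hB
  have := hsq.pow 2
  simp only [ne_eq, OfNat.ofNat_ne_zero, not_false_eq_true, zero_pow] at this
  refine this.congr fun n ↦ ?_
  exact Real.sq_sqrt (integral_nonneg fun x ↦ by positivity)

/-! ## §2 Mean values along the dilation orbit and the cost of small dilations -/

/-- **Mean value theorem along the dilation orbit of a test function**: for `η > −1`, `η ≠ 0`
there is `ξ` strictly between `0` and `η` with
`Re Q(g_η) − Re Q(g) = η · 𝒱(g_ξ)/(1+ξ)` (`𝒱 = weilDilationVirial`; the orbit derivative is
`hasDerivAt_re_weilQuadratic_weilDilate_of_gt`). [cite: Bombieri2000Weil, §4 proof of Thm 5 (the dilation)] -/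
theorem exists_re_weilQuadratic_weilDilate_sub_eq {g : ℝ → ℂ} (hg : IsWeilTest g) {η : ℝ}
    (hη : -1 < η) (hη0 : η ≠ 0) :
    ∃ ξ : ℝ, min 0 η < ξ ∧ ξ < max 0 η ∧
      (weilQuadratic (weilDilate η g)).re - (weilQuadratic g).re =
        η * (weilDilationVirial (weilDilate ξ g) / (1 + ξ)) := by
  set F : ℝ → ℝ := fun s ↦ (weilQuadratic (weilDilate s g)).re with hFdef
  set F' : ℝ → ℝ := fun s ↦ weilDilationVirial (weilDilate s g) / (1 + s) with hF'def
  have hd : ∀ s : ℝ, -1 < s → HasDerivAt F (F' s) s := fun s hs ↦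
    hasDerivAt_re_weilQuadratic_weilDilate_of_gt hg hs
  have hF0 : F 0 = (weilQuadratic g).re := by simp [hFdef]
  rcases lt_or_gt_of_ne hη0 with hneg | hpos
  · have hcont : ContinuousOn F (Icc η 0) := fun s hs ↦
      ((hd s (lt_of_lt_of_le hη hs.1)).continuousAt).continuousWithinAt
    obtain ⟨c, hc, hcF⟩ := exists_hasDerivAt_eq_slope F F' hneg hcont
      (fun s hs ↦ hd s (hη.trans hs.1))
    refine ⟨c, by rw [min_eq_right hneg.le]; exact hc.1, by rw [max_eq_left hneg.le]; exact hc.2,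
      ?_⟩
    have hne : (0 : ℝ) - η ≠ 0 := sub_ne_zero.2 (Ne.symm hη0)
    have h2 : F' c * (0 - η) = F 0 - F η := by rw [hcF, div_mul_cancel₀ _ hne]
    show F η - (weilQuadratic g).re = η * F' c
    rw [← hF0]
    linear_combination h2
  · have hcont : ContinuousOn F (Icc 0 η) := fun s hs ↦
      ((hd s (by linarith [hs.1])).continuousAt).continuousWithinAt
    obtain ⟨c, hc, hcF⟩ := exists_hasDerivAt_eq_slope F F' hpos hcont
      (fun s hs ↦ hd s (by linarith [hs.1]))
    refine ⟨c, by rw [min_eq_left hpos.le]; exact hc.1, by rw [max_eq_right hpos.le]; exact hc.2,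
      ?_⟩
    have hne : η - 0 ≠ 0 := by rwa [sub_zero]
    have h2 : F' c * (η - 0) = F η - F 0 := by rw [hcF, div_mul_cancel₀ _ hne]
    show F η - (weilQuadratic g).re = η * F' c
    rw [← hF0]
    linear_combination -h2

/-- **Small dilations cost little energy, uniformly on bounded-energy unit tests of a window**
(sequence form of `exists_weilDilate_modulus`): if `θₙ → 0` then
`Re Q((gₙ)_{θₙ}) − Re Q(gₙ) → 0` for unit tests `gₙ` of a fixed window with eventually bounded
energy. [cite: Suzuki2026, §4.3–§4.4 (proof of Thm. 1.3)] -/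
theorem tendsto_re_weilQuadratic_weilDilate_sub {L E : ℝ} (hL : 0 < L) {g : ℕ → ℝ → ℂ}
    (hg : ∀ n, IsWeilTest (g n) ∧ tsupport (g n) ⊆ Icc (-L) L ∧ ∫ t, ‖g n t‖ ^ 2 = (1 : ℝ))
    (hE : ∀ᶠ n in atTop, (weilQuadratic (g n)).re ≤ E) {θ : ℕ → ℝ}
    (hθ : Tendsto θ atTop (𝓝 0)) :
    Tendsto (fun n ↦ (weilQuadratic (weilDilate (θ n) (g n))).re - (weilQuadratic (g n)).re)
      atTop (𝓝 0) := by
  rw [Metric.tendsto_nhds]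
  intro ε hε
  obtain ⟨δ, hδ, -, hmod⟩ := exists_weilDilate_modulus hL E (half_pos hε)
  have hθδ : ∀ᶠ n in atTop, |θ n| < δ := by
    have := Metric.tendsto_nhds.1 hθ δ hδ
    simpa [Real.dist_eq] using this
  filter_upwards [hE, hθδ] with n hn hθn
  rw [Real.dist_eq, sub_zero]
  exact (hmod (θ n) hθn.le (g n) (hg n).1 (hg n).2.1 (hg n).2.2 hn).trans_lt (half_lt_self hε)

end Summit.RiemannHypothesis.RiemannHypothesis.Theorems.PfPersistence

end
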